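import Summits.Ventures.Crystal3D.Theorems.StickyWulffConstantTextureBuildMeshV4
import HarnessLib

/-!
# TB-1: the LABELLED POLYHEDRAL MESH v5 = v4 + the three clauses the texture assembly's facet census needs (prism laterals, solidity guards, riser halo)
# (lane T, crux `TextureLiminfV5`, stmt-Ventures-23912; repair census HOME/wulff-p2/g20/TB-D-1-g20.md §2–§3)

HONEST FRAMING. Venture `Summits/Ventures/Crystal3D` (cell `crystal3d-full`), route `route-Ventures-StickyWulffConstant`, helper `--supports` the
law-v5 crux `TextureLiminfV5` (stmt-Ventures-23912).  DEFINITIONS (interface v5 = v4 + five `Prop` fields) + the level-2 composition re-typed (pure logic;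
census-free, standard axioms).  No mesh is constructed, no texture is built; rung F-C1 not moved.

WHY v5 (TB-D-1-g20 §2, the facet-by-facet census of the `PieceData` construction behind `stub_TB_energy`).  Three facet classes have no payer under `Mesh₄`
as typed — each a one-cell / one-gap-piece mesh satisfying `Mesh₄` for which NO texture meets `energy ≤ tentBudget + chargeSum + riserSum + gapCost`:
* (Δ1) `hPlat` — a prism facet that is not a designated lateral (`latP`) lies at WRAPPED heights (`≤ −R₀` or `≥ h + R₀`, where `hwrap₁/₂` supply the covering
  territory).  `Mesh₃` only has `hlatP : latP k ⊆ HP k` and the area budget `hlatArea`, so `latP k = ∅` was admissible and the inner lateral surface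
  `2πρ(h + 2R₀)` of every cell was in nobody's budget (TB-D-0 §1 (O2) intended «latArea := the area of the lateral faces»).
* (Δ2) `hQmatch₅` / `hBmatch₅` — the own-territory option of the gap-facet and riser-box-facet matching clauses is GUARDED by free-zone solidity
  (`z ∈ U g → SolidAt g z`), exactly as `hwrap₁/₂` and the cross-territory options already are (and as `Mesh` v1's `hQmatch` was).  Unguarded, a non-designated
  gap or box facet may be glued to an EMPTY corner of its label's territory (`hbdry`'s `EmptyAt` case) and is then an unpaid exposed facet.
* (Δ3) `hBown₅` / `hBhalo` — riser balls are owned by a riser piece OF THE SAME column-grain pair (so that `hBV` identifies their site sets), and every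
  configuration ball on the two column stackings within distance `1` of a box is so owned OR has all its in-plane neighbour sites occupied: the curtain
  facets inside a box within `1/√3` of a (designated) box facet can be sourced by an occupied site just outside the box, whose riser budget must exist.
Everything else is inherited from `Mesh₄` through `toMesh₄` (and `Mesh₃` through `toMesh₃`); the v3/v4 fields `hQmatch`, `hBmatch`, `hBown` stay (implied
readings), the v5 fields are the ones the assembly uses.
-/

noncomputable section

open scoped BigOperators InnerProductSpace
open MeasureTheory

namespace Summit.Ventures.Crystal3D.Cruxes.TextureLiminf.TexShadow

open Summit.Ventures.Crystal3D Summit.Ventures.Crystal3D.Theorems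

namespace RiseredCover

variable {C R₀ : ℝ} {N : ℕ} {x : Fin N → E3}

/-- riser pieces `r`, `r'` join the same UNORDERED pair of column grains -/
def samePair (rc : RiseredCover C R₀ N x) (r r' : Fin rc.nr) : Prop :=
  (rc.rtL r' = rc.rtL r ∧ rc.rtR r' = rc.rtR r) ∨ (rc.rtL r' = rc.rtR r ∧ rc.rtR r' = rc.rtL r)

/-- `samePair` is reflexive. -/
theorem samePair_refl (rc : RiseredCover C R₀ N x) (r : Fin rc.nr) : rc.samePair r r := Or.inl ⟨rfl, rfl⟩

/-- `samePair` is symmetric. -/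
theorem samePair_symm (rc : RiseredCover C R₀ N x) {r r' : Fin rc.nr} (h : rc.samePair r r') : rc.samePair r' r := by
  rcases h with ⟨h1, h2⟩ | ⟨h1, h2⟩
  · exact Or.inl ⟨h1.symm, h2.symm⟩
  · exact Or.inr ⟨h2.symm, h1.symm⟩

end RiseredCover

open scoped Classical in
/-- **The labelled polyhedral mesh, v5**: `Mesh₄` + wrapped non-lateral prism facets + solidity-guarded own-territory matches of gap pieces and riser
boxes + same-pair riser ownership with the `1`-halo clause. -/
structure Mesh₅ {C R₀ : ℝ} {N : ℕ} {x : Fin N → E3} (rc : RiseredCover C R₀ N x) (δ : ℝ) extends Mesh₄ rc δ where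
  /-- (Δ1) a prism facet that is not a designated lateral lies at wrapped heights -/
  hPlat : ∀ k, ∀ p ∈ HP k \ latP k, ∀ y ∈ facetOf (HP k) p, rc.height k y ≤ -R₀ ∨ (rc.cell k).h + R₀ ≤ rc.height k y
  /-- (Δ2) matching of the non-designated gap facets, own-territory option GUARDED by free-zone solidity -/
  hQmatch₅ : ∀ l, ∀ p ∈ HQ l \ desQ l, ∀ y ∈ facetOf (HQ l) p, ∃ r : ℝ, 0 < r ∧
    Metric.ball y r ⊆ closure (polytope (HQ l)) ∪
      ({z | z ∈ closure (⋃ j, polytope (HD (lab l) j)) ∧ (z ∈ (rc.tent (lab l)).U → rc.SolidAt (lab l) z)} ∪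
        (⋃ k ∈ (Finset.univ.filter fun k => fk k = lab l), (closure (polytope (HP k)) ∩ {z | rc.height k z ≤ -1})) ∪
        (⋃ k ∈ (Finset.univ.filter fun k => gk k = lab l), (closure (polytope (HP k)) ∩ {z | (rc.cell k).h + 1 ≤ rc.height k z})) ∪
        (⋃ l' ∈ (Finset.univ.filter fun l' => lab l' = lab l), closure (polytope (HQ l'))) ∪
        (⋃ r' ∈ (Finset.univ.filter fun r' => rc.rtL r' = lab l ∨ rc.rtR r' = lab l), closure (polytope (HB r'))) ∪
        (⋃ g ∈ (Finset.univ.filter fun g => g ≠ lab l), {z | z ∈ closure (⋃ j, polytope (HD g j)) ∧ (z ∈ (rc.tent g).U → rc.SolidAt g z) ∧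
          ∃ r' : ℝ, 0 < r' ∧ rc.S (lab l) ∩ Metric.ball z (r' + 4) = rc.S g ∩ Metric.ball z (r' + 4)}))
  /-- (Δ2) matching of the non-designated riser-box facets, the matched column grain's territory option GUARDED by free-zone solidity -/
  hBmatch₅ : ∀ r, ∀ p ∈ HB r \ desB r, ∀ y ∈ facetOf (HB r) p, ∃ ρ' : ℝ, 0 < ρ' ∧ ∃ g : Fin rc.ng, (g = rc.rtL r ∨ g = rc.rtR r) ∧
    rc.CompleteAt (rc.S g) (ρ' + 4) y ∧
    Metric.ball y ρ' ⊆ closure (polytope (HB r)) ∪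
      ({z | z ∈ closure (⋃ j, polytope (HD g j)) ∧ (z ∈ (rc.tent g).U → rc.SolidAt g z)} ∪
        (⋃ k ∈ (Finset.univ.filter fun k => fk k = g), (closure (polytope (HP k)) ∩ {z | rc.height k z ≤ -1})) ∪
        (⋃ k ∈ (Finset.univ.filter fun k => gk k = g), (closure (polytope (HP k)) ∩ {z | (rc.cell k).h + 1 ≤ rc.height k z})) ∪
        (⋃ l ∈ (Finset.univ.filter fun l => lab l = g), closure (polytope (HQ l))) ∪
        (⋃ r' ∈ (Finset.univ.filter fun r' => r' ≠ r ∧ (rc.rtL r' = rc.rtL r ∧ rc.rtR r' = rc.rtR r ∨ rc.rtL r' = rc.rtR r ∧ rc.rtR r' = rc.rtL r)),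
          closure (polytope (HB r'))))
  /-- (Δ3) the owner of a configuration ball in a closed riser box is a riser piece of the same column-grain pair -/
  hBown₅ : ∀ r, ∀ q ∈ rc.X', q ∈ closure (polytope (HB r)) → ∃ r', q ∈ rc.rown r' ∧ rc.samePair r r'
  /-- (Δ3) the `1`-halo: a configuration ball on one of the two column stackings within distance `1` of the box is owned by a riser piece of the same pair,
  or all its in-plane neighbour sites (in that stacking) are occupied -/
  hBhalo : ∀ r, ∀ q ∈ rc.X', (q ∈ rc.S (rc.rtL r) ∨ q ∈ rc.S (rc.rtR r)) → Metric.infDist q (polytope (HB r)) < 1 →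
    (∃ r', q ∈ rc.rown r' ∧ rc.samePair r r') ∨
      ((q ∈ rc.S (rc.rtL r) → ∀ v ∈ rc.S (rc.rtL r), dist q v = 1 → ⟪v - q, rc.rn r⟫_ℝ = 0 → v ∈ rc.X') ∧
        (q ∈ rc.S (rc.rtR r) → ∀ v ∈ rc.S (rc.rtR r), dist q v = 1 → ⟪v - q, rc.rn r⟫_ℝ = 0 → v ∈ rc.X'))

namespace Mesh₅

variable {C R₀ : ℝ} {N : ℕ} {x : Fin N → E3} {rc : RiseredCover C R₀ N x} {δ : ℝ}

/-- the gap cost (inherited from v3 through v4) -/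
def gapCost (μ : Mesh₅ rc δ) : ℝ := μ.toMesh₄.gapCost

/-- `gapCost` is that of the underlying v4 mesh. -/
theorem gapCost_eq (μ : Mesh₅ rc δ) : μ.gapCost = μ.toMesh₄.gapCost := rfl

/-- `gapCost` is that of the underlying v3 mesh. -/
theorem gapCost_eq₃ (μ : Mesh₅ rc δ) : μ.gapCost = μ.toMesh₃.gapCost := rfl

/-- The v5 gap matching implies the v3 one (the guard is dropped). -/
theorem hQmatch_of_hQmatch₅ (μ : Mesh₅ rc δ) (l : Fin μ.nQ) (p : E3 × ℝ) (hp : p ∈ μ.HQ l \ μ.desQ l) (y : E3)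
    (hy : y ∈ facetOf (μ.HQ l) p) : ∃ r : ℝ, 0 < r ∧
    Metric.ball y r ⊆ closure (polytope (μ.HQ l)) ∪
      ((closure (⋃ j, polytope (μ.HD (μ.lab l) j))) ∪
        (⋃ k ∈ (Finset.univ.filter fun k => μ.fk k = μ.lab l), (closure (polytope (μ.HP k)) ∩ {z | rc.height k z ≤ -1})) ∪
        (⋃ k ∈ (Finset.univ.filter fun k => μ.gk k = μ.lab l), (closure (polytope (μ.HP k)) ∩ {z | (rc.cell k).h + 1 ≤ rc.height k z})) ∪
        (⋃ l' ∈ (Finset.univ.filter fun l' => μ.lab l' = μ.lab l), closure (polytope (μ.HQ l'))) ∪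
        (⋃ r' ∈ (Finset.univ.filter fun r' => rc.rtL r' = μ.lab l ∨ rc.rtR r' = μ.lab l), closure (polytope (μ.HB r'))) ∪
        (⋃ g ∈ (Finset.univ.filter fun g => g ≠ μ.lab l), {z | z ∈ closure (⋃ j, polytope (μ.HD g j)) ∧ (z ∈ (rc.tent g).U → rc.SolidAt g z) ∧
          ∃ r' : ℝ, 0 < r' ∧ rc.S (μ.lab l) ∩ Metric.ball z (r' + 4) = rc.S g ∩ Metric.ball z (r' + 4)})) := by
  obtain ⟨r, hr, hsub⟩ := μ.hQmatch₅ l p hp y hy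
  refine ⟨r, hr, fun z hz => ?_⟩
  rcases hsub hz with h | ((((( h | h) | h) | h) | h) | h)
  · exact Or.inl h
  · exact Or.inr (Or.inl (Or.inl (Or.inl (Or.inl (Or.inl h.1)))))
  · exact Or.inr (Or.inl (Or.inl (Or.inl (Or.inl (Or.inr h)))))
  · exact Or.inr (Or.inl (Or.inl (Or.inl (Or.inr h))))
  · exact Or.inr (Or.inl (Or.inl (Or.inr h)))
  · exact Or.inr (Or.inl (Or.inr h))
  · exact Or.inr (Or.inr h)

end Mesh₅

/-! ## The level-2 composition of record (mesh v5, slack form) -/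

/-- **THE LEVEL-2 COMPOSITION over risered cover + mesh v5, WITH SLACK** (adhesion hypothesis arbitrary): «TB-cover v5» + «TB-energy v5» + the wall law
⇒ the atomic-scale saturated shadow theorem. -/
theorem shadowTheoremSatAtomicV5_of_risered₅_slack {Adh : Prop}
    (hcover : BarlowResolution → Adh →
      ∀ C R₀ : ℝ, 1 ≤ R₀ → ∀ K δ θ : ℝ, 0 < δ → 0 < θ → ∃ N₀ : ℕ, ∀ N : ℕ, N₀ ≤ N → ∀ x : Fin N → E3, IsUnitPacking x →
        IsSaturated x → 6 * (N : ℝ) - (numContacts x : ℝ) ≤ K * (N : ℝ) ^ ((2 : ℝ) / 3) →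
        ∃ (rc : RiseredCover C R₀ N x) (μ : Mesh₅ rc δ),
          rc.tilingLoss₂ + rc.rimSum + μ.gapCost ≤ θ * (N : ℝ) ^ ((2 : ℝ) / 3) + rc.unownedSlack₃)
    (henergy : PolytopeCalculus → BarlowFreeCertificate →
      ∀ (C R₀ : ℝ) (N : ℕ) (x : Fin N → E3) (δ : ℝ) (rc : RiseredCover C R₀ N x) (μ : Mesh₅ rc δ),
        ∃ (n : ℕ) (G : Fin n → Set E3) (A : Fin n → (E3 ≃ₗᵢ[ℝ] E3)) (c : Fin n → Fin n → ℝ) (m : Fin n → Fin n → E3),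
          IsTexture (13 / 25) (1 / 2) n G A c m ∧ (1 - δ) * (N : ℝ) ≤ Real.sqrt 2 * vol n G ∧
          energy n G A c m ≤ rc.tentBudget + rc.chargeSum + rc.riserSum + μ.gapCost) :
    BarlowResolution → Adh → BilayerWallV5 → PolytopeCalculus → BarlowFreeCertificate → ShadowTheoremSatAtomicV5 := by
  intro hres hadh hBW hpoly hfree _hG _hC _hNRG _hSL K δ θ hδ hθ
  obtain ⟨C, R₀, hR₀, hW⟩ := hBW
  obtain ⟨N₀, hN₀⟩ := hcover hres hadh C R₀ hR₀ K δ θ hδ hθ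
  refine ⟨N₀, fun N hN x hx hsat hK => ?_⟩
  obtain ⟨rc, μ, hslack⟩ := hN₀ N hN x hx hsat hK
  obtain ⟨n, G, A, c, m, hT, hvol, hEn⟩ := henergy hpoly hfree C R₀ N x δ rc μ
  refine ⟨n, G, A, c, m, hT, hvol, ?_⟩
  have hdisc := rc.tentBudget_add_chargeSum_le₃_slack hR₀ hW
  linarith

/-- **THE v8.8+ COMPOSITION OF RECORD (mesh v5)**: TB-cover v5 + TB-energy v5 ⇒ the registered shape of `stub_textureBuild` (adhesion `BarlowAdhesionTCap` or any `Adh`). -/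
theorem textureBuildR₅_of_stubs {Adh : Prop}
    (hcover : BarlowResolution → Adh →
      ∀ C R₀ : ℝ, 1 ≤ R₀ → ∀ K δ θ : ℝ, 0 < δ → 0 < θ → ∃ N₀ : ℕ, ∀ N : ℕ, N₀ ≤ N → ∀ x : Fin N → E3, IsUnitPacking x →
        IsSaturated x → 6 * (N : ℝ) - (numContacts x : ℝ) ≤ K * (N : ℝ) ^ ((2 : ℝ) / 3) →
        ∃ (rc : RiseredCover C R₀ N x) (μ : Mesh₅ rc δ),
          rc.tilingLoss₂ + rc.rimSum + μ.gapCost ≤ θ * (N : ℝ) ^ ((2 : ℝ) / 3) + rc.unownedSlack₃)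
    (henergy : PolytopeCalculus → BarlowFreeCertificate →
      ∀ (C R₀ : ℝ) (N : ℕ) (x : Fin N → E3) (δ : ℝ) (rc : RiseredCover C R₀ N x) (μ : Mesh₅ rc δ),
        ∃ (n : ℕ) (G : Fin n → Set E3) (A : Fin n → (E3 ≃ₗᵢ[ℝ] E3)) (c : Fin n → Fin n → ℝ) (m : Fin n → Fin n → E3),
          IsTexture (13 / 25) (1 / 2) n G A c m ∧ (1 - δ) * (N : ℝ) ≤ Real.sqrt 2 * vol n G ∧
          energy n G A c m ≤ rc.tentBudget + rc.chargeSum + rc.riserSum + μ.gapCost) :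
    BarlowResolution → Adh → BilayerWallV5 → PolytopeCalculus → BarlowFreeCertificate → ShadowTheoremSatV5 :=
  textureBuild_of_atomic (shadowTheoremSatAtomicV5_of_risered₅_slack hcover henergy)

end Summit.Ventures.Crystal3D.Cruxes.TextureLiminf.TexShadow

end
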